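import Summits.BirchSwinnertonDyer.BirchSwinnertonDyer.Theorems.GenusKolyvaginAtTwoTorsionCellGenusDepth
import Summits.BirchSwinnertonDyer.BirchSwinnertonDyer.Theorems.ByReductionTypeAtTwoRankOneAtTwoBigImageOddLocalOneDoorBottomHeegnerClass
import HarnessLib

/-!
# LINE 49 «full_vertex» — the genus-depth lemma MODULO TORSION (Theorem A of the pen's memo #6 on `E₀(K_gen)` itself)

Crux R″ `RankOneTwoTorsionResidualAtTwo` (stmt-BirchSwinnertonDyer-27478) of route GenusKolyvaginAtTwo, LINE 49
«torsion_cell_full_vertex_bsdidea1» (pen bsd-idea-1); sequel of `…TorsionCellGenusDepth` (memo #6 §2, Theorem A on a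
TORSION-FREE `Λ`).  The dictionary of memo #6 takes `Λ = E₀(K_gen)/E₀[2]` (torsion-free once `E₀(K_gen)_tors = E₀[2]`);
to spare any future kernel use the quotient, this file restates Theorem A and the (LOW) dictionary on an ARBITRARY additive
group `A` with a `G`-action by group automorphisms (`DistribMulAction`), all conclusions being read MODULO THE TORSION
SUBGROUP `AddCommGroup.torsion A` — i.e. directly on `A = E₀(K_gen)` with «`+ tors`» as in «`y_K ∈ 2^{k−1}E₀(K) + tors`».

* `smul_mem_torsion`, `twistedTrace_mem_torsion` — the action and the twisted traces preserve torsion;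
* (`n • z ∈ tors`, `n ≠ 0` ⟹ `z ∈ tors` is the tree's `RankOneAtTwoOneDoor.mem_torsion_of_zsmul_mem_torsion`, reused);
* `twistedTrace_sub`, `twistedTrace_zsmul` — additivity of `y ↦ ∑ g, χ g • g • y`;
* **`twistedTrace_sub_smul_mem_torsion_of_decomposition`** (THEOREM A ⟸ mod torsion): `|G| = 2^k`, `e ≤ k`, `χᵢ`
  pairwise distinct, `Pᵢ` exact `χᵢ`-eigenvectors, `2^e • y − ∑ᵢ Pᵢ ∈ tors` ⟹ `∑ g, χᵢ g • g • y − 2^(k−e) • Pᵢ ∈ tors`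
  («`2^e y_G ∈ M′ + tors ⟹ y_χ ∈ 2^{k−e} ℤ g′_χ + tors`»; `e = 1`: (LOW)_k with torsion);
* **`zsmul_sub_sum_mem_torsion_of_twistedTrace`** (THEOREM A ⟹ mod torsion) over the full separating character group;
* **`two_pow_smul_mem_span_sup_torsion_iff`** — THE DICTIONARY mod torsion:
  `2^e • y ∈ M′ ⊔ tors ↔ ∀ χ, ∃ a, ∑ h, χ h • h • y − (2^(k−e)·a) • g χ ∈ tors`, `M′ = span ℤ (range g)` (as an additive
  subgroup: `(Submodule.span ℤ (Set.range g)).toAddSubgroup`).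

Everything is proved (no `sorry`, standard axioms); nothing here is a statement of the line, and NOTHING HERE PROVES R″ or any
summit — BSD is not advanced by this file alone.

## References

* [Serre1977] J.-P. Serre, *Linear Representations of Finite Groups*, §2.3.
* [TianYuanZhang2017] Y. Tian, X. Yuan, S.-W. Zhang, *Genus periods, genus points and congruent number problem*, §1.
-/

namespace Summit.BirchSwinnertonDyer.BirchSwinnertonDyer.Theorems.GenusKolyvaginAtTwo.FullVertex.GenusDepth

open BigOperators Finset
open Summit.BirchSwinnertonDyer.BirchSwinnertonDyer.Theorems.RankOneAtTwoOneDoor (mem_torsion_of_zsmul_mem_torsion)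

variable {G : Type*} [Group G] [Fintype G]
variable {A : Type*} [AddCommGroup A] [DistribMulAction G A]

omit [Fintype G] in
/-- The action by group automorphisms preserves the torsion subgroup. [cite: Serre1977, §2.3] -/
theorem smul_mem_torsion (g : G) {t : A} (ht : t ∈ AddCommGroup.torsion A) : g • t ∈ AddCommGroup.torsion A := by
  rw [AddCommGroup.mem_torsion, isOfFinAddOrder_iff_nsmul_eq_zero] at ht ⊢
  obtain ⟨n, hn, hnt⟩ := ht
  exact ⟨n, hn, by rw [smul_comm, hnt, smul_zero]⟩

omit [Fintype G] in
/-- Integer multiples of torsion elements are torsion. [cite: Serre1977, §2.3] -/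
theorem zsmul_mem_torsion (n : ℤ) {t : A} (ht : t ∈ AddCommGroup.torsion A) : n • t ∈ AddCommGroup.torsion A :=
  AddSubgroup.zsmul_mem _ ht n

/-- Twisted traces of torsion elements are torsion. [cite: Serre1977, §2.3] -/
theorem twistedTrace_mem_torsion (χ : G →* ℤˣ) {t : A} (ht : t ∈ AddCommGroup.torsion A) :
    ∑ g : G, ((χ g : ℤˣ) : ℤ) • g • t ∈ AddCommGroup.torsion A :=
  AddSubgroup.sum_mem _ fun g _ => zsmul_mem_torsion _ (smul_mem_torsion g ht)

/-- Twisted traces are additive: `tw χ (a − b) = tw χ a − tw χ b`. [cite: Serre1977, §2.3] -/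
theorem twistedTrace_sub (χ : G →* ℤˣ) (a b : A) :
    ∑ g : G, ((χ g : ℤˣ) : ℤ) • g • (a - b) =
      ∑ g : G, ((χ g : ℤˣ) : ℤ) • g • a - ∑ g : G, ((χ g : ℤˣ) : ℤ) • g • b := by
  rw [← Finset.sum_sub_distrib]
  refine Finset.sum_congr rfl fun g _ => ?_
  rw [smul_sub, smul_sub]

/-- Twisted traces are additive over finite sums. [cite: Serre1977, §2.3] -/
theorem twistedTrace_sum {ι : Type*} (s : Finset ι) (χ : G →* ℤˣ) (P : ι → A) :
    ∑ g : G, ((χ g : ℤˣ) : ℤ) • g • (∑ j ∈ s, P j) = ∑ j ∈ s, ∑ g : G, ((χ g : ℤˣ) : ℤ) • g • P j := by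
  rw [Finset.sum_comm]
  refine Finset.sum_congr rfl fun g _ => ?_
  rw [Finset.smul_sum, Finset.smul_sum]

omit [Fintype G] in
/-- The twisted trace of an exact `χ`-eigenvector is `|G| •` it (`χ g ^ 2 = 1`). [cite: Serre1977, §2.3] -/
theorem twistedTrace_self_eig [Fintype G] (χ : G →* ℤˣ) {P : A} (hP : ∀ g : G, g • P = ((χ g : ℤˣ) : ℤ) • P) :
    ∑ g : G, ((χ g : ℤˣ) : ℤ) • g • P = (Fintype.card G : ℤ) • P := by
  have h : ∀ g : G, ((χ g : ℤˣ) : ℤ) • g • P = P := fun g => by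
    rw [hP g, smul_smul, Int.units_coe_mul_self, one_smul]
  rw [Finset.sum_congr rfl fun g _ => h g, Finset.sum_const, Finset.card_univ, natCast_zsmul]

/-- **THEOREM A (⟸) MODULO TORSION.**  If `|G| = 2^k`, `e ≤ k`, the characters `χᵢ` are pairwise distinct, the `Pᵢ` are
exact `χᵢ`-eigenvectors, and `2^e • y − ∑ᵢ Pᵢ` is TORSION, then `∑ g, χᵢ g • g • y − 2^(k−e) • Pᵢ` is torsion for every `i`
(«`2^e y_G ∈ M′ + tors ⟹ y_χ ∈ 2^{k−e} ℤ g′_χ + tors`»; with `e = 1` this is (LOW)_k read in `E₀(K_gen)` itself).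
[cite: TianYuanZhang2017, §1] [cite: Serre1977, §2.3] -/
theorem twistedTrace_sub_smul_mem_torsion_of_decomposition {k e : ℕ} (hG : Fintype.card G = 2 ^ k) (he : e ≤ k)
    {ι : Type*} [Fintype ι] [DecidableEq ι] (χ : ι → (G →* ℤˣ)) (hχ : Function.Injective χ) (P : ι → A)
    (hP : ∀ i, ∀ g : G, g • P i = ((χ i g : ℤˣ) : ℤ) • P i) (y : A)
    (hy : ((2 : ℤ) ^ e) • y - ∑ j, P j ∈ AddCommGroup.torsion A) (i : ι) :
    ∑ g : G, ((χ i g : ℤˣ) : ℤ) • g • y - ((2 : ℤ) ^ (k - e)) • P i ∈ AddCommGroup.torsion A := by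
  -- apply the (additive) twisted trace to the torsion element `2^e • y − ∑ P j`
  have ht := twistedTrace_mem_torsion (χ i) hy
  rw [twistedTrace_sub, twistedTrace_zsmul_comm, twistedTrace_sum_eig χ hχ P hP i, hG] at ht
  -- `ht : 2^e • tw y − (2^k : ℕ) • P i ∈ tors`; factor `2^e`
  refine mem_torsion_of_zsmul_mem_torsion (pow_ne_zero e (two_ne_zero : (2 : ℤ) ≠ 0)) ?_
  have hfac : ((2 : ℤ) ^ e) • (∑ g : G, ((χ i g : ℤˣ) : ℤ) • g • y - ((2 : ℤ) ^ (k - e)) • P i) =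
      ((2 : ℤ) ^ e) • ∑ g : G, ((χ i g : ℤˣ) : ℤ) • g • y - ((2 ^ k : ℕ) : ℤ) • P i := by
    rw [smul_sub, smul_smul, ← pow_add, Nat.add_sub_cancel' he]
    push_cast
    rfl
  rw [hfac]
  exact ht

/-- **THEOREM A (⟹) MODULO TORSION.**  Over the full character group (of order `2^k`, separating `G`): if every twisted
trace satisfies `∑ g, χ g • g • y − 2^(k−e) • P χ ∈ tors`, then `2^e • y − ∑_χ P χ ∈ tors`.
[cite: TianYuanZhang2017, §1] [cite: Serre1977, §2.3] -/
theorem zsmul_sub_sum_mem_torsion_of_twistedTrace [Fintype (G →* ℤˣ)] {k e : ℕ}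
    (hdual : Fintype.card (G →* ℤˣ) = 2 ^ k) (hsep : ∀ g : G, g ≠ 1 → ∃ χ : G →* ℤˣ, χ g ≠ 1) (he : e ≤ k)
    (y : A) (P : (G →* ℤˣ) → A)
    (htw : ∀ χ : G →* ℤˣ, ∑ g : G, ((χ g : ℤˣ) : ℤ) • g • y - ((2 : ℤ) ^ (k - e)) • P χ ∈ AddCommGroup.torsion A) :
    ((2 : ℤ) ^ e) • y - ∑ χ, P χ ∈ AddCommGroup.torsion A := by
  classical
  have hsum := AddSubgroup.sum_mem (AddCommGroup.torsion A) fun χ (_ : χ ∈ (univ : Finset (G →* ℤˣ))) => htw χ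
  rw [Finset.sum_sub_distrib, sum_twistedTrace_eq hsep y, hdual, ← Finset.smul_sum] at hsum
  -- `hsum : (2^k : ℕ) • y − 2^(k−e) • ∑ P ∈ tors`; factor `2^(k−e)`
  refine mem_torsion_of_zsmul_mem_torsion (pow_ne_zero (k - e) (two_ne_zero : (2 : ℤ) ≠ 0)) ?_
  have hfac : ((2 : ℤ) ^ (k - e)) • (((2 : ℤ) ^ e) • y - ∑ χ, P χ) =
      ((2 ^ k : ℕ) : ℤ) • y - ((2 : ℤ) ^ (k - e)) • ∑ χ, P χ := by
    rw [smul_sub, smul_smul, ← pow_add, Nat.sub_add_cancel he]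
    push_cast
    rfl
  rw [hfac]
  exact hsum

/-- **THE DICTIONARY MODULO TORSION.**  With one exact `χ`-eigenvector `g χ` per character, `|G| = |Ĝ| = 2^k`, `Ĝ`
separating `G`, `e ≤ k`, and `M′ = span ℤ (range g)` as an additive subgroup:
`2^e • y ∈ M′ ⊔ tors ↔ ∀ χ, ∃ a : ℤ, ∑ h, χ h • h • y − (2^(k−e)·a) • g χ ∈ tors`
(«`2^e y_G ∈ M′ + tors ⟺` every `y_χ ∈ 2^{k−e} ℤ g′_χ + tors`»; `e = 1`: (LOW)_k). [cite: TianYuanZhang2017, §1] -/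
theorem two_pow_smul_mem_span_sup_torsion_iff [Fintype (G →* ℤˣ)] {k e : ℕ}
    (hG : Fintype.card G = 2 ^ k) (hdual : Fintype.card (G →* ℤˣ) = 2 ^ k)
    (hsep : ∀ g : G, g ≠ 1 → ∃ χ : G →* ℤˣ, χ g ≠ 1) (he : e ≤ k)
    (g : (G →* ℤˣ) → A) (hg : ∀ χ : G →* ℤˣ, ∀ h : G, h • g χ = ((χ h : ℤˣ) : ℤ) • g χ) (y : A) :
    ((2 : ℤ) ^ e) • y ∈ (Submodule.span ℤ (Set.range g)).toAddSubgroup ⊔ AddCommGroup.torsion A ↔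
      ∀ χ : G →* ℤˣ, ∃ a : ℤ,
        ∑ h : G, ((χ h : ℤˣ) : ℤ) • h • y - (((2 : ℤ) ^ (k - e)) * a) • g χ ∈ AddCommGroup.torsion A := by
  classical
  constructor
  · intro hy χ
    obtain ⟨m, hm, t, ht, hmt⟩ := AddSubgroup.mem_sup.mp hy
    obtain ⟨c, hc⟩ := (Submodule.mem_span_range_iff_exists_fun ℤ).mp (show m ∈ Submodule.span ℤ (Set.range g) from hm)
    refine ⟨c χ, ?_⟩
    have hdec : ((2 : ℤ) ^ e) • y - ∑ ψ, c ψ • g ψ ∈ AddCommGroup.torsion A := by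
      rw [hc, ← hmt, add_sub_cancel_left]; exact ht
    have h := twistedTrace_sub_smul_mem_torsion_of_decomposition hG he (fun ψ : G →* ℤˣ => ψ) (fun _ _ h => h)
      (fun ψ => c ψ • g ψ) (fun ψ h' => by rw [smul_comm, hg ψ h', smul_comm]) y hdec χ
    rwa [smul_smul] at h
  · intro h
    choose a ha using h
    have hdec := zsmul_sub_sum_mem_torsion_of_twistedTrace hdual hsep he y (fun χ => a χ • g χ)
      (fun χ => by rw [smul_smul]; exact ha χ)
    refine AddSubgroup.mem_sup.mpr ⟨∑ χ, a χ • g χ, ?_, ((2 : ℤ) ^ e) • y - ∑ χ, a χ • g χ, hdec, add_sub_cancel _ _⟩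
    exact Submodule.sum_mem _ fun χ _ => Submodule.smul_mem _ _ (Submodule.subset_span ⟨χ, rfl⟩)

/-- `e = 1`: the (LOW)_k line with torsion — `2 • y ∈ M′ + tors` iff every twisted trace is `2^(k−1) ℤ g χ + tors`.
[cite: TianYuanZhang2017, §1] -/
theorem two_smul_mem_span_sup_torsion_iff [Fintype (G →* ℤˣ)] {k : ℕ}
    (hG : Fintype.card G = 2 ^ k) (hdual : Fintype.card (G →* ℤˣ) = 2 ^ k)
    (hsep : ∀ g : G, g ≠ 1 → ∃ χ : G →* ℤˣ, χ g ≠ 1) (hk : 1 ≤ k)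
    (g : (G →* ℤˣ) → A) (hg : ∀ χ : G →* ℤˣ, ∀ h : G, h • g χ = ((χ h : ℤˣ) : ℤ) • g χ) (y : A) :
    (2 : ℤ) • y ∈ (Submodule.span ℤ (Set.range g)).toAddSubgroup ⊔ AddCommGroup.torsion A ↔
      ∀ χ : G →* ℤˣ, ∃ a : ℤ,
        ∑ h : G, ((χ h : ℤˣ) : ℤ) • h • y - (((2 : ℤ) ^ (k - 1)) * a) • g χ ∈ AddCommGroup.torsion A := by
  simpa using two_pow_smul_mem_span_sup_torsion_iff hG hdual hsep hk g hg y

/-! ### Appendix (g37, same session): the structural consequences modulo torsion -/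

/-- **COROLLARY ((S′) ⟹ (LOW)) MODULO TORSION.**  If EVERY element of `A` has an `e`-decomposition modulo torsion over the
(distinct) characters `χᵢ` («`exp(A/(M′ + tors)) ∣ 2^e`»), then every twisted trace of every `y` is `2^(k−e)` times an exact
`χᵢ`-eigenvector up to torsion (memo #6 Theorem B: `v₂(m_χ) ≥ k − j_χ`). [cite: TianYuanZhang2017, §1] -/
theorem twistedTrace_depth_of_exponent_torsion {k e : ℕ} (hG : Fintype.card G = 2 ^ k) (he : e ≤ k)
    {ι : Type*} [Fintype ι] [DecidableEq ι] (χ : ι → (G →* ℤˣ)) (hχ : Function.Injective χ)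
    (hA : ∀ x : A, ∃ P : ι → A, (∀ i, ∀ g : G, g • P i = ((χ i g : ℤˣ) : ℤ) • P i) ∧
      ((2 : ℤ) ^ e) • x - ∑ j, P j ∈ AddCommGroup.torsion A)
    (y : A) (i : ι) :
    ∃ Q : A, (∀ g : G, g • Q = ((χ i g : ℤˣ) : ℤ) • Q) ∧
      ∑ g : G, ((χ i g : ℤˣ) : ℤ) • g • y - ((2 : ℤ) ^ (k - e)) • Q ∈ AddCommGroup.torsion A := by
  obtain ⟨P, hP, hy⟩ := hA y
  exact ⟨P i, hP i, twistedTrace_sub_smul_mem_torsion_of_decomposition hG he χ hχ P hP y hy i⟩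

/-- **EXPONENT MODULO TORSION (memo #6 §2.3 on `E₀(K_gen)` itself).**  If every exact `χ`-eigenvector of `A` is an integer
multiple of `g χ` UP TO TORSION (rank-one eigenlines: `E₀^{(d)}(ℚ) = ℤ g′_d + tors`), then `|Ĝ| • x ∈ M′ ⊔ tors` for EVERY
`x ∈ A` (with `|Ĝ| = 2^k`: `exp(A/(M′ + tors)) ∣ 2^k`): each twisted trace of `x` is an exact eigenvector
(`smul_twistedTrace`), hence in `ℤ g χ + tors`, and their sum over `χ` is `|Ĝ| • x` (`sum_twistedTrace_eq`).
[cite: TianYuanZhang2017, §1] -/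
theorem card_dual_smul_mem_span_sup_torsion [Fintype (G →* ℤˣ)]
    (hsep : ∀ g : G, g ≠ 1 → ∃ χ : G →* ℤˣ, χ g ≠ 1) (g : (G →* ℤˣ) → A)
    (hsat : ∀ χ : G →* ℤˣ, ∀ P : A, (∀ h : G, h • P = ((χ h : ℤˣ) : ℤ) • P) →
      ∃ a : ℤ, P - a • g χ ∈ AddCommGroup.torsion A) (x : A) :
    (Fintype.card (G →* ℤˣ) : ℤ) • x ∈ (Submodule.span ℤ (Set.range g)).toAddSubgroup ⊔ AddCommGroup.torsion A := by
  classical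
  rw [← sum_twistedTrace_eq hsep x]
  refine AddSubgroup.sum_mem _ fun χ _ => ?_
  obtain ⟨a, ha⟩ := hsat χ (∑ h : G, ((χ h : ℤˣ) : ℤ) • h • x) (smul_twistedTrace χ x)
  refine AddSubgroup.mem_sup.mpr ⟨a • g χ, ?_, _, ha, add_sub_cancel _ _⟩
  exact Submodule.smul_mem _ _ (Submodule.subset_span ⟨χ, rfl⟩)

/-- The exponent bound in `2`-power form modulo torsion: `|Ĝ| = 2^k` and rank-one eigenlines up to torsion ⟹
`2^k • x ∈ M′ ⊔ tors` for every `x`. [cite: TianYuanZhang2017, §1] -/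
theorem two_pow_card_smul_mem_span_sup_torsion [Fintype (G →* ℤˣ)] {k : ℕ} (hdual : Fintype.card (G →* ℤˣ) = 2 ^ k)
    (hsep : ∀ g : G, g ≠ 1 → ∃ χ : G →* ℤˣ, χ g ≠ 1) (g : (G →* ℤˣ) → A)
    (hsat : ∀ χ : G →* ℤˣ, ∀ P : A, (∀ h : G, h • P = ((χ h : ℤˣ) : ℤ) • P) →
      ∃ a : ℤ, P - a • g χ ∈ AddCommGroup.torsion A) (x : A) :
    ((2 : ℤ) ^ k) • x ∈ (Submodule.span ℤ (Set.range g)).toAddSubgroup ⊔ AddCommGroup.torsion A := by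
  have h := card_dual_smul_mem_span_sup_torsion hsep g hsat x
  rw [hdual] at h
  exact_mod_cast h

end Summit.BirchSwinnertonDyer.BirchSwinnertonDyer.Theorems.GenusKolyvaginAtTwo.FullVertex.GenusDepth
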